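import Summits.SmoothPoincare4.SmoothPoincare4.Theorems.ConvexBisectionAcyclicBisectionExistsPageInvarianceTwisting
import HarnessLib

/-!
# Calculus on the Lefschetz base model for the page rotation: differentials of `w` and `rho`
(wave 3, brick T1a, part 1, of stub `stub_steinRealisation` = NF6
`Literature.Geometry.Symplectic.steinRealisation_of_sorted_modelsOnFibred`, line `modp-braid-orbits`
r11, crux `ConvexBisection.AcyclicBisectionExists`, item stmt-SmoothPoincare4-10508; registered
sub-goal `helper_fderiv_rho_apply`)

The base `Base g = {rho g ≤ 1/4} ⊂ ℂ² = ℝ⁴` (`LefschetzBaseModel.lean`, `LefschetzBaseRegular.lean`;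
`rho g = ‖w‖² + eta ‖x‖²`, `w = y² − x^{2g+1} − 1`) is moved inside `ℝ⁴` by flows of explicit
vector fields (the page rotation of NF6 T1, the sequel `…PageRotationField.lean`).  Such a flow
preserves the base as soon as the field is tangent to the levels of `rho`, and rotates the pages
as soon as `dw` of the field is `i·w`; this file turns both conditions into formulas:

* §1 `contDiff_mk₂`, `ContDiffAt.mk₂` — `(a, b) ↦ mk a b ∈ ℝ⁴` is smooth (real-linear), so a field
  given by two smooth complex components is smooth;
* §2 `fderiv_w_apply` — **`dw_p(v) = dPhiX g p · cx v + dPhiY p · cy v`** (`dPhiX = −(2g+1)x^{2g}`,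
  `dPhiY = 2y`, `LefschetzBasePages.lean` §6), and `fderiv_rho_apply` /
  `helper_fderiv_rho_apply` — **`d rho_p(v) = 2 Re(w̄ · dw_p(v)) + eta'(‖x‖²) · 2 Re(x̄ · cx v)`**,
  both by differentiating along the line `t ↦ p + t v` (the tree's `hasDerivAt_comp_line`,
  `hasDerivAt_norm_sq_comp`) and uniqueness of derivatives;
* §3 two a priori facts on the neighbourhood `{rho < 1/2}` of the base: it misses the origin
  (`rho 0 = 1`), and over `‖x‖² ≥ 3` the coordinate `y` does not vanish there
  (`cy_ne_zero_of_rho_lt_half`: `y = 0` forces `‖w‖ ≥ ‖x‖ − 1 ≥ √3 − 1`, `‖w‖² > 1/2`) — this is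
  where the vertical rotation field `(0, i w/(2y))` of the sequel is smooth;
* §4 `{rho g ≤ 2/5}` is compact (`‖p‖² ≤ 8 + 3^{4g+2}`, as for the base) — the support of the
  rotation field.

Everything is proved; no named facts, no `sorry`.  References: R. İ. Baykur, *Kähler decomposition
of 4-manifolds*, AGT 6 (2006), proof of Thm. 5.1 [Baykur2006]; R. E. Gompf, A. I. Stipsicz,
*4-Manifolds and Kirby Calculus* (1999), §8.2.
-/

noncomputable section

set_option linter.dupNamespace false

open scoped Manifold ContDiff Topology ComplexConjugate
open Set Function Metric
open Literature.Topology.FourManifolds Literature.Topology.FourManifolds.LefschetzBase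

namespace Summit.SmoothPoincare4.SmoothPoincare4.Theorems.AcyclicBisectionExists.ModpBraidOrbits

variable {g : ℕ}

/-! ## §1 Smoothness of `mk` -/

/-- `(a, b) ↦ mk a b` is smooth (it is real-linear). [folklore] -/
theorem contDiff_mk₂ : ContDiff ℝ ∞ fun z : ℂ × ℂ => mk z.1 z.2 := by
  refine contDiff_euclidean.2 fun i => ?_
  fin_cases i
  · simpa [mk, Function.comp_def] using Complex.reCLM.contDiff.comp contDiff_fst
  · simpa [mk, Function.comp_def] using Complex.imCLM.contDiff.comp contDiff_fst
  · simpa [mk, Function.comp_def] using Complex.reCLM.contDiff.comp contDiff_snd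
  · simpa [mk, Function.comp_def] using Complex.imCLM.contDiff.comp contDiff_snd

/-- Smoothness of `q ↦ mk (f q) (h q)` at a point. [folklore] -/
theorem ContDiffAt.mk₂ {E : Type*} [NormedAddCommGroup E] [NormedSpace ℝ E] {f h : E → ℂ} {q : E}
    (hf : ContDiffAt ℝ ∞ f q) (hh : ContDiffAt ℝ ∞ h q) :
    ContDiffAt ℝ ∞ (fun p => mk (f p) (h p)) q :=
  contDiff_mk₂.contDiffAt.comp q (hf.prodMk hh)

/-! ## §2 The differentials of `w` and `rho` in an arbitrary direction -/

/-- The derivative of a complex-valued function along the line `t ↦ p + t v` is its Fréchet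
derivative applied to `v`. [folklore] -/
theorem hasDerivAt_comp_line_complex {f : EuclideanSpace ℝ (Fin 4) → ℂ} (hf : Differentiable ℝ f)
    (p v : EuclideanSpace ℝ (Fin 4)) :
    HasDerivAt (fun t : ℝ => f (p + t • v)) (fderiv ℝ f p v) 0 := by
  have hl : HasDerivAt (fun t : ℝ => p + t • v) v 0 := by
    have h := ((hasDerivAt_id (0 : ℝ)).smul_const v).const_add p
    rw [one_smul] at h
    exact h
  have h := (hf (p + (0 : ℝ) • v)).hasFDerivAt.comp_hasDerivAt (0 : ℝ) hl
  rw [zero_smul, add_zero] at h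
  exact h

/-- `w` along a general line: `w (p + t v) = (y + t y')² − (x + t x')^{2g+1} − 1`. [folklore] -/
theorem w_add_smul (g : ℕ) (p v : EuclideanSpace ℝ (Fin 4)) (t : ℝ) :
    w g (p + t • v) = (cy p + (t : ℂ) * cy v) ^ 2 - (cx p + (t : ℂ) * cx v) ^ (2 * g + 1) - 1 := by
  simp only [w, Phi, cx_add, cx_smul, cy_add, cy_smul]

/-- Derivative of `w` along a general line at `t = 0`: `dΦ(v) = a · x' + b · y'` with
`a = dPhiX = −(2g+1) x^{2g}`, `b = dPhiY = 2y`. [folklore] -/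
theorem hasDerivAt_w_add_smul (g : ℕ) (p v : EuclideanSpace ℝ (Fin 4)) :
    HasDerivAt (fun t : ℝ => w g (p + t • v)) (dPhiX g p * cx v + dPhiY p * cy v) 0 := by
  have h1 : HasDerivAt (fun t : ℝ => (cx p + (t : ℂ) * cx v) ^ (2 * g + 1))
      ((2 * g + 1 : ℕ) * (cx p + ((0 : ℝ) : ℂ) * cx v) ^ (2 * g + 1 - 1) * (1 * cx v)) 0 :=
    (((hasDerivAt_ofReal' 0).mul_const (cx v)).const_add (cx p)).pow (2 * g + 1)
  have h2 : HasDerivAt (fun t : ℝ => (cy p + (t : ℂ) * cy v) ^ 2)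
      ((2 : ℕ) * (cy p + ((0 : ℝ) : ℂ) * cy v) ^ (2 - 1) * (1 * cy v)) 0 :=
    (((hasDerivAt_ofReal' 0).mul_const (cy v)).const_add (cy p)).pow 2
  have h := (h2.sub h1).sub_const 1
  have hfun : (fun t : ℝ => w g (p + t • v)) =
      fun t : ℝ => (cy p + (t : ℂ) * cy v) ^ 2 - (cx p + (t : ℂ) * cx v) ^ (2 * g + 1) - 1 :=
    funext (w_add_smul g p v)
  rw [hfun]
  refine h.congr_deriv ?_
  simp only [Complex.ofReal_zero, zero_mul, add_zero, one_mul, dPhiX, dPhiY, Nat.cast_ofNat,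
    Nat.add_sub_cancel]
  push_cast
  ring

/-- **The differential of `w`**: `dw_p(v) = dPhiX g p · cx v + dPhiY p · cy v`. [folklore] -/
theorem fderiv_w_apply (g : ℕ) (p v : EuclideanSpace ℝ (Fin 4)) :
    fderiv ℝ (w g) p v = dPhiX g p * cx v + dPhiY p * cy v :=
  (hasDerivAt_comp_line_complex ((contDiff_w g).differentiable (by simp)) p v).unique
    (hasDerivAt_w_add_smul g p v)

/-- `‖x‖²` along a general line. [folklore] -/
theorem hasDerivAt_norm_sq_cx_add_smul (p v : EuclideanSpace ℝ (Fin 4)) :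
    HasDerivAt (fun t : ℝ => ‖cx (p + t • v)‖ ^ 2) (2 * (conj (cx p) * cx v).re) 0 := by
  have h : HasDerivAt (fun t : ℝ => cx p + (t : ℂ) * cx v) (1 * cx v) 0 :=
    ((hasDerivAt_ofReal' 0).mul_const (cx v)).const_add (cx p)
  have h' := hasDerivAt_norm_sq_comp h
  have hfun : (fun t : ℝ => ‖cx (p + t • v)‖ ^ 2) = fun t : ℝ => ‖cx p + (t : ℂ) * cx v‖ ^ 2 := by
    funext t; rw [cx_add, cx_smul]
  rw [hfun]
  refine h'.congr_deriv ?_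
  simp

/-- **The differential of `rho`**:
`d rho_p(v) = 2 Re(conj(w p) · dw_p(v)) + eta'(‖x‖²) · 2 Re(conj(x) · cx v)`. [folklore] -/
theorem fderiv_rho_apply (g : ℕ) (p v : EuclideanSpace ℝ (Fin 4)) :
    fderiv ℝ (rho g) p v = 2 * (conj (w g p) * fderiv ℝ (w g) p v).re +
      deriv eta (‖cx p‖ ^ 2) * (2 * (conj (cx p) * cx v).re) := by
  have hρ := hasDerivAt_comp_line ((contDiff_rho g).differentiable (by simp)) p v
  have h1 := hasDerivAt_norm_sq_comp
    (hasDerivAt_comp_line_complex ((contDiff_w g).differentiable (by simp)) p v)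
  have hin := hasDerivAt_norm_sq_cx_add_smul p v
  have hout : HasDerivAt eta (deriv eta (‖cx (p + (0 : ℝ) • v)‖ ^ 2)) (‖cx (p + (0 : ℝ) • v)‖ ^ 2) :=
    ((contDiff_eta.differentiable (by simp)) _).hasDerivAt
  have h2 := hout.comp 0 hin
  have h := h1.add h2
  simp only [zero_smul, add_zero] at h hρ
  exact hρ.unique h

/-! ## §3 Two a priori facts near the base -/

/-- Near the base (`rho < 1/2`) and over `‖x‖² ≥ 3`, the coordinate `y` does not vanish: if
`y = 0` then `‖w‖ = ‖x^{2g+1} + 1‖ ≥ ‖x‖ − 1 ≥ √3 − 1`, so `rho ≥ ‖w‖² > 1/2`. [folklore] -/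
theorem cy_ne_zero_of_rho_lt_half {q : EuclideanSpace ℝ (Fin 4)} (hρ : rho g q < 1 / 2)
    (hx : 3 ≤ ‖cx q‖ ^ 2) : cy q ≠ 0 := by
  intro hy
  have hx1 : (173 / 100 : ℝ) ≤ ‖cx q‖ := by nlinarith [norm_nonneg (cx q)]
  have hone : 1 ≤ ‖cx q‖ := by linarith
  have hpow : ‖cx q‖ ≤ ‖cx q‖ ^ (2 * g + 1) := by
    calc ‖cx q‖ = ‖cx q‖ ^ 1 := (pow_one _).symm
      _ ≤ ‖cx q‖ ^ (2 * g + 1) := pow_le_pow_right₀ hone (by omega)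
  have hw : ‖cx q‖ - 1 ≤ ‖w g q‖ := by
    have : w g q = -(cx q ^ (2 * g + 1) + 1) := by simp [w, Phi, hy]; ring
    rw [this, norm_neg]
    have h3 : ‖cx q ^ (2 * g + 1)‖ ≤ ‖cx q ^ (2 * g + 1) + 1‖ + ‖(1 : ℂ)‖ := by
      have := norm_sub_le (cx q ^ (2 * g + 1) + 1) 1
      rwa [add_sub_cancel_right] at this
    rw [norm_pow, norm_one] at h3
    linarith
  have hρ' : ‖w g q‖ ^ 2 ≤ rho g q := by
    unfold rho; linarith [eta_nonneg (‖cx q‖ ^ 2)]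
  nlinarith

/-- Near the base (`rho < 1/2`) no point is the origin (`rho 0 = 1`). [folklore] -/
theorem ne_zero_of_rho_lt_half {q : EuclideanSpace ℝ (Fin 4)} (hρ : rho g q < 1 / 2) : q ≠ 0 := by
  rintro rfl
  rw [rho_zero] at hρ
  norm_num at hρ

/-! ## §4 The compact neighbourhood `{rho ≤ 2/5}` of the base -/

/-- `{rho g ≤ 2/5}` is bounded: `‖p‖² ≤ 8 + 3^{4g+2}` (as for the base: `‖x‖² < 6` since
`eta 6 ≥ 1/2 > 2/5`, and `‖w‖ ≤ 1`). [folklore] -/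
theorem norm_sq_le_of_rho_le_two_fifths {p : EuclideanSpace ℝ (Fin 4)} (hp : rho g p ≤ 2 / 5) :
    ‖p‖ ^ 2 ≤ 8 + (3 : ℝ) ^ (4 * g + 2) := by
  have hw : ‖w g p‖ ^ 2 ≤ 2 / 5 := by unfold rho at hp; linarith [eta_nonneg (‖cx p‖ ^ 2)]
  have hx : ‖cx p‖ ^ 2 < 6 := by
    by_contra h
    have : (1 / 2 : ℝ) ≤ eta (‖cx p‖ ^ 2) := half_le_eta_six.trans (eta_monotone (not_lt.1 h))
    unfold rho at hp
    nlinarith [sq_nonneg ‖w g p‖]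
  have hx3 : ‖cx p‖ ≤ 3 := by nlinarith [norm_nonneg (cx p)]
  have hwn : ‖w g p‖ ≤ 1 := by nlinarith [norm_nonneg (w g p)]
  have hy : cy p ^ 2 = w g p + 1 + cx p ^ (2 * g + 1) := by simp only [w, Phi]; ring
  have hxn : ‖cx p ^ (2 * g + 1)‖ ≤ (3 : ℝ) ^ (2 * g + 1) := by
    rw [norm_pow]; exact pow_le_pow_left₀ (norm_nonneg _) hx3 _
  have hy2 : ‖cy p‖ ^ 2 ≤ 2 + (3 : ℝ) ^ (2 * g + 1) := by
    rw [← norm_pow, hy]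
    have := norm_add₃_le (a := w g p) (b := (1 : ℂ)) (c := cx p ^ (2 * g + 1))
    rw [norm_one] at this
    linarith
  have h3 : (3 : ℝ) ^ (2 * g + 1) ≤ 3 ^ (4 * g + 2) := pow_le_pow_right₀ (by norm_num) (by omega)
  rw [norm_sq_eq]
  linarith

/-- `{rho g ≤ 2/5}` is compact. [folklore] -/
theorem isCompact_rho_le_two_fifths (g : ℕ) :
    IsCompact (rho g ⁻¹' Iic (2 / 5) : Set (EuclideanSpace ℝ (Fin 4))) := by
  refine Metric.isCompact_of_isClosed_isBounded
    (isClosed_Iic.preimage (contDiff_rho g).continuous) ?_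
  rw [isBounded_iff_forall_norm_le]
  refine ⟨8 + (3 : ℝ) ^ (4 * g + 2), fun p hp => ?_⟩
  have h := norm_sq_le_of_rho_le_two_fifths (g := g) hp
  have h0 : (0 : ℝ) ≤ 3 ^ (4 * g + 2) := by positivity
  nlinarith [norm_nonneg p]

/-! ## §5 The registered sub-goal -/

/-- **The differential of the defining function of the base in an arbitrary direction**
(registered sub-goal `helper_fderiv_rho_apply` of NF6, brick T1a):
`d rho_p(v) = 2 Re(conj(w p) · dw_p(v)) + eta'(‖x‖²) · 2 Re(conj(x) · cx v)` on `ℝ⁴ = ℂ²`, for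
`rho g = ‖w g‖² + eta ∘ ‖cx‖²` — the formula by which a vector field with `dw(V) ∈ iℝ · w` and
`dx(V) = 0` wherever `eta' ≠ 0` is tangent to `∂ Base g = {rho g = 1/4}` (the page-rotation field
of Baykur's fibred isotopy of `F × D²`). [cite: Baykur2006, proof of Thm. 5.1, pp. 13–14] -/
theorem helper_fderiv_rho_apply :
    ∀ (g : ℕ) (p v : EuclideanSpace ℝ (Fin 4)),
      fderiv ℝ (Literature.Topology.FourManifolds.LefschetzBase.rho g) p v =
        2 * (starRingEnd ℂ (Literature.Topology.FourManifolds.LefschetzBase.w g p) *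
          fderiv ℝ (Literature.Topology.FourManifolds.LefschetzBase.w g) p v).re +
        deriv Literature.Topology.FourManifolds.LefschetzBase.eta
          (‖Literature.Topology.FourManifolds.LefschetzBase.cx p‖ ^ 2) *
          (2 * (starRingEnd ℂ (Literature.Topology.FourManifolds.LefschetzBase.cx p) *
            Literature.Topology.FourManifolds.LefschetzBase.cx v).re) :=
  fun g p v => fderiv_rho_apply g p v

end Summit.SmoothPoincare4.SmoothPoincare4.Theorems.AcyclicBisectionExists.ModpBraidOrbits
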